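import Literature.Barriers.CriticalPhenomena.LaceExpansionXSpaceTwoLongLinesAssembly
import Literature.Barriers.CriticalPhenomena.LaceExpansionXSpaceTriangleNumerics
import Literature.Barriers.CriticalPhenomena.LaceExpansionXSpaceNormsProofs
import Literature.Barriers.CriticalPhenomena.LaceExpansionPcInputs
import Literature.Barriers.CriticalPhenomena.LaceExpansionXSpaceBootstrap
import HarnessLib

/-!
# Hara's two-long-lines estimate (Hara 2008, §3.5) at `p_c`: reduction of the named fact
# `Hara2008_twoLongLinesDiagramBoundPc` to its two leaf inputs — PROVED

Barrier catalogue `Literature/Barriers/CriticalPhenomena/` (D-0021). The named fact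
`Hara2008_twoLongLinesDiagramBoundPc` (`LaceExpansionXSpaceLemma15Diagrams.lean`) is Hara's
diagrammatic estimate of §3.5 SPECIALISED TO `p = p_c` with a geometric rate `q < 1`; at `p_c` the
rate is `κ = 2Δ̃_{p_c}Δ̄_{p_c}` and the constant is a power of `𝕂 = 2d(S̄_{p_c}+1)`
(`LaceExpansionXSpaceTwoLongLinesAssembly.piNDiagramPc_succ_le_sum`, proved for every `d` in
`[0, ∞]`). That `κ < 1` and `S̄ < ∞` in `d ≥ 11` is exactly the content of the two leaf inputs of
the catalogue — the Fitzner–van der Hofstad numerics (`FitznerVanDerHofstad2017_triangleBoundsPc`,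
giving `2Δ̃Δ̄ ≤ 2·0.28036·1.53562 < 1`) and Hara's Proposition 1.2 (`Hara2008_prop12Pc`, giving the
weighted summability of `Π` from which Lemma 1.7 (`Hara2008_lemma17Pc_holds`) yields `S̄^{(0)} < ∞`).
PROVED here:

* `twoLongLines_real`: for `d ≥ 1` with `S̄_{p_c} < ∞` and `κ < 1`, the conclusion of
  `Hara2008_twoLongLinesDiagramBoundPc d` with `q = max(κ, 1/2)` and `C = 22·4·32·(2d)²·𝕂¹⁸`;
* `Hara2008_twoLongLinesDiagramBoundPc_of_leafInputs`:
  `FitznerVanDerHofstad2017_triangleBoundsPc → Hara2008_prop12Pc → Hara2008_twoLongLinesDiagramBoundPc`.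

The unconditional `Hara2008_twoLongLinesDiagramBoundPc_holds` is therefore blocked exactly on these
two catalogued leaves (no other input of Hara's §3.5 remains unformalized).

## References

* T. Hara, *Decay of correlations in nearest-neighbor self-avoiding walk, percolation, lattice
  trees and animals*, Ann. Probab. 36 (2008) 530–593, arXiv:math-ph/0504021: §3.5, §3.4, Lemma 1.7,
  Prop. 1.2.
* R. Fitzner, R. van der Hofstad, *Mean-field behavior for nearest-neighbor percolation in
  `d > 10`*, Electron. J. Probab. 22 (2017), §7 (numerical triangle bounds).
* M. Heydenreich, R. van der Hofstad, *Progress in High-Dimensional Percolation and Random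
  Graphs*, Springer 2017, §7.4–7.5.
-/

noncomputable section

open scoped ENNReal

namespace Literature.Barriers.CriticalPhenomena

open _root_.MeasureTheory Literature.Probability.LatticeModels Literature.Probability.Percolation

variable {d : ℕ}

/-- The rate loses at most five units: `q^{n-4} ≤ 32 q^{n+1}` for `1/2 ≤ q`. [folklore] -/
theorem pow_sub_four_le {q : ℝ} (hq : 1 / 2 ≤ q) (n : ℕ) : q ^ (n - 4) ≤ 32 * q ^ (n + 1) := by
  have hq0 : 0 ≤ q := le_trans (by norm_num) hq
  rcases le_or_gt 4 n with hn | hn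
  · calc q ^ (n - 4) = 32 * (q ^ (n - 4) * (1 / 2) ^ 5) := by ring
      _ ≤ 32 * (q ^ (n - 4) * q ^ 5) := by gcongr
      _ = 32 * q ^ (n + 1) := by rw [← pow_add, show n - 4 + 5 = n + 1 by omega]
  · rw [show n - 4 = 0 by omega, pow_zero]
    calc (1 : ℝ) ≤ 32 * (1 / 2) ^ 4 := by norm_num
      _ ≤ 32 * (1 / 2) ^ (n + 1) := by
          refine mul_le_mul_of_nonneg_left (pow_le_pow_of_le_one (by norm_num) (by norm_num) (by omega)) (by norm_num)
      _ ≤ 32 * q ^ (n + 1) := by gcongr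

/-- **Hara's §3.5 at `p_c` with real constants**: if `S̄_{p_c} < ∞` and `κ = 2Δ̃Δ̄ < 1` then the
conclusion of `Hara2008_twoLongLinesDiagramBoundPc d` holds with `q = max(κ, 1/2)`. [cite: Hara2008, §3.5] -/
theorem twoLongLines_real (hd : 1 ≤ d) (hS : percSqBar d < ⊤) (hκ1 : kap d < 1) :
    ∃ C q : ℝ, 0 < q ∧ q < 1 ∧
      ∀ (N : ℕ), 1 ≤ N → ∀ (x : Site d) (b : ℝ), x ≠ 0 →
        (∀ y : Site d, euclidNorm x / (2 * N + 1) - 1 ≤ euclidNorm y → tau d (criticalProbI d) 0 y ≤ b) →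
        piNDiagramPc d N x ≤ ENNReal.ofReal (C * ((N : ℝ) + 1) ^ 2 * q ^ N * b ^ 2) := by
  -- finiteness of the constants
  have hK : bigK d < ⊤ := by
    rw [bigK]
    exact ENNReal.mul_lt_top (ENNReal.mul_lt_top (by simp) (by simp)) (ENNReal.add_lt_top.2 ⟨hS, by simp⟩)
  have hK18 : bigK d ^ 18 ≠ ⊤ := (ENNReal.pow_lt_top hK).ne
  have hκtop : kap d ≠ ⊤ := (hκ1.trans ENNReal.one_lt_top).ne
  set Kr : ℝ := (bigK d ^ 18).toReal with hKr
  set κr : ℝ := (kap d).toReal with hκr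
  have hκr0 : 0 ≤ κr := ENNReal.toReal_nonneg
  have hκr1 : κr < 1 := by
    have h := (ENNReal.toReal_lt_toReal hκtop ENNReal.one_ne_top).2 hκ1
    simpa using h
  have hKr0 : 0 ≤ Kr := ENNReal.toReal_nonneg
  set q : ℝ := max κr (1 / 2) with hq
  have hq0 : 0 < q := lt_max_of_lt_right (by norm_num)
  have hq1 : q < 1 := max_lt hκr1 (by norm_num)
  have hq2 : 1 / 2 ≤ q := le_max_right _ _
  refine ⟨22 * 4 * 32 * Kr * (2 * d) ^ 2, q, hq0, hq1, fun N hN x b hx hb => ?_⟩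
  obtain ⟨n, rfl⟩ : ∃ n, N = n + 1 := ⟨N - 1, by omega⟩
  -- `b ≥ 0` (the hypothesis at `y = x`)
  have hb0 : 0 ≤ b := (tau_nonneg _ _ _).trans (hb x (threshold_le_euclidNorm x (n + 1)))
  -- the bound in `[0, ∞]`
  have hmain := piNDiagramPc_succ_le_sum hd hκ1.le hx hb
  set T : ℝ≥0∞ := 22 * (2 * (n : ℝ≥0∞) + 1) ^ 2 * (wβ d b ^ 2 * (bigK d ^ 18 * kap d ^ (n - 4))) with hT
  have hwβ : wβ d b = ENNReal.ofReal (2 * d * b) := by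
    rw [wβ, ENNReal.ofReal_mul (by positivity), ENNReal.ofReal_mul zero_le_two, ENNReal.ofReal_ofNat,
      ENNReal.ofReal_natCast]
  have hTtop : T ≠ ⊤ := by
    refine (ENNReal.mul_lt_top (ENNReal.mul_lt_top (by simp) (ENNReal.pow_lt_top ?_))
      (ENNReal.mul_lt_top (ENNReal.pow_lt_top ?_) (ENNReal.mul_lt_top (ENNReal.pow_lt_top hK)
        (ENNReal.pow_lt_top (hκ1.trans ENNReal.one_lt_top))))).ne
    · exact ENNReal.add_lt_top.2 ⟨ENNReal.mul_lt_top (by simp) (by simp), by simp⟩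
    · rw [hwβ]; exact ENNReal.ofReal_lt_top
  -- its real value
  have hTr : T.toReal = 22 * (2 * (n : ℝ) + 1) ^ 2 * ((2 * d * b) ^ 2 * (Kr * κr ^ (n - 4))) := by
    rw [hT, hwβ, ENNReal.toReal_mul, ENNReal.toReal_mul, ENNReal.toReal_mul, ENNReal.toReal_mul, ENNReal.toReal_pow,
      ENNReal.toReal_pow, ENNReal.toReal_pow, ENNReal.toReal_ofReal (by positivity), ENNReal.toReal_add (ENNReal.mul_ne_top (by norm_num) (ENNReal.natCast_ne_top n)) ENNReal.one_ne_top,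
      ENNReal.toReal_mul]
    simp [hKr, hκr]
  -- the real inequality
  have key : (2 * (n : ℝ) + 1) ^ 2 * κr ^ (n - 4) ≤ 4 * ((n : ℝ) + 2) ^ 2 * (32 * q ^ (n + 1)) := by
    have hsq : (2 * (n : ℝ) + 1) ^ 2 ≤ 4 * ((n : ℝ) + 2) ^ 2 :=
      calc (2 * (n : ℝ) + 1) ^ 2 ≤ (2 * (n : ℝ) + 4) ^ 2 := pow_le_pow_left₀ (by positivity) (by linarith) 2
        _ = 4 * ((n : ℝ) + 2) ^ 2 := by ring
    exact mul_le_mul hsq (((pow_le_pow_left₀ hκr0 (le_max_left _ _) _).trans (pow_sub_four_le hq2 n)))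
      (pow_nonneg hκr0 _) (by positivity)
  have hreal : T.toReal ≤ 22 * 4 * 32 * Kr * (2 * d) ^ 2 * (((n + 1 : ℕ) : ℝ) + 1) ^ 2 * q ^ (n + 1) * b ^ 2 := by
    rw [hTr]
    calc 22 * (2 * (n : ℝ) + 1) ^ 2 * ((2 * d * b) ^ 2 * (Kr * κr ^ (n - 4)))
        = 22 * Kr * (2 * d) ^ 2 * b ^ 2 * ((2 * (n : ℝ) + 1) ^ 2 * κr ^ (n - 4)) := by ring
      _ ≤ 22 * Kr * (2 * d) ^ 2 * b ^ 2 * (4 * ((n : ℝ) + 2) ^ 2 * (32 * q ^ (n + 1))) :=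
          mul_le_mul_of_nonneg_left key (by positivity)
      _ = 22 * 4 * 32 * Kr * (2 * d) ^ 2 * (((n + 1 : ℕ) : ℝ) + 1) ^ 2 * q ^ (n + 1) * b ^ 2 := by push_cast; ring
  calc piNDiagramPc d (n + 1) x ≤ T := hmain
    _ = ENNReal.ofReal T.toReal := (ENNReal.ofReal_toReal hTtop).symm
    _ ≤ _ := ENNReal.ofReal_le_ofReal hreal

/-- **`Hara2008_twoLongLinesDiagramBoundPc` from its two leaf inputs.** The Fitzner–van der Hofstad
numerics give `κ = 2Δ̃_{p_c}Δ̄_{p_c} < 1` in `d ≥ 11`; Hara's Proposition 1.2 gives the weighted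
summability of `Π_{p_c}` from which Lemma 1.7 (proved: `Hara2008_lemma17Pc_holds`) gives
`S̄^{(0)}_{p_c} < ∞`; the rest is `twoLongLines_real`, i.e. Hara's §3.5 formalized in the files
`LaceExpansionXSpaceTwoLongLines*.lean`, `LaceExpansionXSpaceLongLineInsertion.lean` and
`LaceExpansionXSpaceMiddleFactor.lean`. [cite: Hara2008, §3.5; FitznerVanDerHofstad2017, §7; Hara2008, Prop. 1.2 & Lemma 1.7] -/
theorem Hara2008_twoLongLinesDiagramBoundPc_of_leafInputs (h₁ : FitznerVanDerHofstad2017_triangleBoundsPc)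
    (h₂ : Hara2008_prop12Pc) : Hara2008_twoLongLinesDiagramBoundPc := by
  intro d hd11
  have hd : 1 ≤ d := le_trans (by norm_num) hd11
  have hκ1 : kap d < 1 := h₁.two_mul_percTriTildeBar_mul_percTriBar_lt_one hd11
  have hS : percSqBar d < ⊤ := by
    rw [percSqBar_eq_haraSBar_zero]
    obtain ⟨Φ, hΦ, hsum⟩ := h₂ d hd11
    have hsum' : Summable fun x : Site d => euclidNorm x ^ (2 : ℝ) * |Φ x| := by
      have h : (fun x : Site d => euclidNorm x ^ (2 : ℝ) * |Φ x|) = fun x => euclidNorm x ^ 2 * |Φ x| := by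
        funext x; rw [Real.rpow_two]
      rw [h]; exact hsum
    have h17 := Hara2008_lemma17Pc_holds d hd11 Φ hΦ 2 le_rfl hsum'
    have hd8 : (0 : ℝ) < (d : ℝ) - 8 := by
      have : (11 : ℝ) ≤ d := by exact_mod_cast hd11
      linarith
    exact h17.2.2.2.1 0 le_rfl not_isOddInt_zero (by exact_mod_cast Int.floor_nonneg.2 (by norm_num : (0 : ℝ) ≤ 2)) hd8
  exact twoLongLines_real hd hS hκ1

end Literature.Barriers.CriticalPhenomena
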